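import Literature.NumberTheory.Automorphic.MirabolicEisensteinSeries
import Literature.NumberTheory.Automorphic.AdelicBoxCount
import Literature.NumberTheory.Automorphic.AdelicLatticeDecaySums
import Literature.NumberTheory.Automorphic.AdelicGLnGlue
import HarnessLib

/-!
# Counting rational vectors `ξ ∈ Kⁿ` by the size of `ξ g`, and the lattice sums
`∑_{ξ ≠ 0} ‖(ξ g)_∞‖^{-θ}`

Topic `NumberTheory/Automorphic`; namespace `Literature.NumberTheory.Automorphic`. Proof file
(theorems only) of the geometry-of-numbers input to the absolute convergence of the mirabolic
Eisenstein series of `GL_n` on `re s > 1` (`MirabolicEisensteinSeries`, named fact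
`summable_mirabolicEisenstein`; Jacquet–Shalika (1981), §4; Cogdell (2004), §2.3): for
`g ∈ GL_n(𝔸_K)` and a compact set `C` of finite-adelic vectors,

* `finite_ncard_ratVec_vecMul_le` — the rational row vectors `ξ ∈ Kⁿ` with `(ξ g)_f ∈ C` and
  `‖(ξ g)_∞‖ ≤ R` are finite in number, at most `C₀ · max(1, R)^{n [K:ℚ]}` (coordinatewise
  `ncard_algebraMap_mem_realAdele_smul_le` of `AdelicBoxCount` after `ξ = (ξ g) g⁻¹`);
* `norm_vecInfinitePart_ratVec_vecMul_pos` — `(ξ g)_∞ ≠ 0` for `ξ ≠ 0`;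
* `tsum_norm_vecInfinitePart_rpow_neg_lt_top` — hence
  `∑_{ξ ≠ 0, (ξ g)_f ∈ C} ‖(ξ g)_∞‖^{-θ} < ∞` for every `θ > n [K:ℚ]`
  (`tsum_rpow_neg_lt_top_of_ncard_le` of `AdelicLatticeDecaySums`).

Here `x_∞ = vecInfinitePart K n x ∈ (K ⊗ ℝ)ⁿ` (sup norm on Mathlib's `mixedSpace K`) and
`x_f = vecFinitePart K n x`; the algebra of these coordinate maps under scalars, matrices and
principal vectors (`vecInfinitePart_smul`, `vecInfinitePart_vecMul`, `vecInfinitePart_ratVec`, …)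
is recorded first. Folklore (Borel, *Introduction aux groupes arithmétiques* (1969), §1, §8;
Godement–Jacquet, LNM 260 (1972), §11, proof of Lemma 11.6).

## References

* A. Borel, *Introduction aux groupes arithmétiques*, Hermann (1969), §1, §8 [Borel1969].
* R. Godement, H. Jacquet, *Zeta functions of simple algebras*, LNM 260 (1972), §11
  [GodementJacquetLNM260].
-/

noncomputable section

open scoped NNReal ENNReal Pointwise Classical
open NumberField NumberField.mixedEmbedding IsDedekindDomain Set Matrix Module

namespace Literature.NumberTheory.Automorphic

/-! ### A norm bound for row vectors times matrices over a normed ring -/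

section NormedRing

variable {R : Type*} [SeminormedRing R] {m k : Type*} [Fintype m] [Fintype k]

/-- `‖z A‖_∞ ≤ (∑_{i,j} ‖A_{ij}‖) ‖z‖_∞` for a row vector `z` and a matrix `A` over a normed ring
(sup norms). [folklore] -/
theorem norm_vecMul_le (z : m → R) (A : Matrix m k R) :
    ‖z ᵥ* A‖ ≤ (∑ i, ∑ j, ‖A i j‖) * ‖z‖ := by
  have h0 : 0 ≤ (∑ i, ∑ j, ‖A i j‖) * ‖z‖ := by positivity
  refine (pi_norm_le_iff_of_nonneg h0).2 fun j => ?_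
  calc ‖(z ᵥ* A) j‖ = ‖∑ i, z i * A i j‖ := rfl
    _ ≤ ∑ i, ‖z i * A i j‖ := norm_sum_le _ _
    _ ≤ ∑ i, ‖z‖ * ‖A i j‖ := Finset.sum_le_sum fun i _ =>
        (norm_mul_le _ _).trans (mul_le_mul_of_nonneg_right (norm_le_pi_norm z i) (norm_nonneg _))
    _ ≤ ∑ i, ‖z‖ * ∑ j', ‖A i j'‖ := Finset.sum_le_sum fun i _ =>
        mul_le_mul_of_nonneg_left
          (Finset.single_le_sum (f := fun j' => ‖A i j'‖) (fun _ _ => norm_nonneg _)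
            (Finset.mem_univ j)) (norm_nonneg _)
    _ = (∑ i, ∑ j, ‖A i j‖) * ‖z‖ := by rw [← Finset.mul_sum, mul_comm]

end NormedRing

/-! ### Archimedean and finite coordinates of adelic vectors -/

section Coordinates

variable (K : Type) [Field K] [NumberField K] {n : ℕ}

/-- The archimedean-coordinate ring homomorphism `𝔸_K → K ⊗ ℝ`, `a ↦ a_∞` read in the mixed
space. [folklore] -/
theorem vecInfinitePart_apply (x : Fin n → AdeleRing (𝓞 K) K) (i : Fin n) :
    vecInfinitePart K n x i = InfiniteAdeleRing.ringEquiv_mixedSpace K (x i).1 := rfl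

/-- `vecFinitePart` is the finite coordinate (definitional). [folklore] -/
theorem vecFinitePart_apply (x : Fin n → AdeleRing (𝓞 K) K) (i : Fin n) :
    vecFinitePart K n x i = (x i).2 := rfl

/-- `(a x)_∞ = a_∞ x_∞`. [folklore] -/
theorem vecInfinitePart_smul (a : AdeleRing (𝓞 K) K) (x : Fin n → AdeleRing (𝓞 K) K) :
    vecInfinitePart K n (a • x) =
      InfiniteAdeleRing.ringEquiv_mixedSpace K a.1 • vecInfinitePart K n x := by
  funext i
  change InfiniteAdeleRing.ringEquiv_mixedSpace K (a * x i).1 =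
    InfiniteAdeleRing.ringEquiv_mixedSpace K a.1 * InfiniteAdeleRing.ringEquiv_mixedSpace K (x i).1
  rw [← map_mul]
  rfl

/-- `(a x)_f = a_f x_f`. [folklore] -/
theorem vecFinitePart_smul (a : AdeleRing (𝓞 K) K) (x : Fin n → AdeleRing (𝓞 K) K) :
    vecFinitePart K n (a • x) = a.2 • vecFinitePart K n x := rfl

/-- `(x A)_∞ = x_∞ A_∞`. [folklore] -/
theorem vecInfinitePart_vecMul (x : Fin n → AdeleRing (𝓞 K) K)
    (A : Matrix (Fin n) (Fin n) (AdeleRing (𝓞 K) K)) :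
    vecInfinitePart K n (x ᵥ* A) =
      vecInfinitePart K n x ᵥ* A.map fun a => InfiniteAdeleRing.ringEquiv_mixedSpace K a.1 := by
  set f : AdeleRing (𝓞 K) K →+* mixedSpace K :=
    (InfiniteAdeleRing.ringEquiv_mixedSpace K).toRingHom.comp
      (RingHom.fst (InfiniteAdeleRing K) (FiniteAdeleRing (𝓞 K) K)) with hf
  have hfa : ∀ a : AdeleRing (𝓞 K) K, InfiniteAdeleRing.ringEquiv_mixedSpace K a.1 = f a :=
    fun a => rfl
  funext j
  rw [vecInfinitePart_apply, hfa, RingHom.map_vecMul]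
  simp_rw [hfa]
  rfl

/-- `(x A)_f = x_f A_f`. [folklore] -/
theorem vecFinitePart_vecMul (x : Fin n → AdeleRing (𝓞 K) K)
    (A : Matrix (Fin n) (Fin n) (AdeleRing (𝓞 K) K)) :
    vecFinitePart K n (x ᵥ* A) = vecFinitePart K n x ᵥ* A.map Prod.snd := by
  set f : AdeleRing (𝓞 K) K →+* FiniteAdeleRing (𝓞 K) K :=
    RingHom.snd (InfiniteAdeleRing K) (FiniteAdeleRing (𝓞 K) K) with hf
  have hfa : ∀ a : AdeleRing (𝓞 K) K, a.2 = f a := fun a => rfl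
  funext j
  rw [vecFinitePart_apply, hfa, RingHom.map_vecMul]
  rfl

/-- The archimedean coordinates of a principal vector are its Minkowski images:
`(ξ)_∞ = (ι(ξ_i))_i`. [folklore] -/
theorem vecInfinitePart_ratVec (v : Fin n → K) :
    vecInfinitePart K n (ratVec K v) = fun i => mixedEmbedding K (v i) := by
  funext i
  rw [vecInfinitePart_apply, InfiniteAdeleRing.mixedEmbedding_eq_algebraMap_comp]
  rfl

/-- The finite coordinates of a principal vector: `(ξ)_f = (ξ_i)_i` in `𝔸_K^∞`. [folklore] -/
theorem vecFinitePart_ratVec (v : Fin n → K) :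
    vecFinitePart K n (ratVec K v) = fun i => algebraMap K (FiniteAdeleRing (𝓞 K) K) (v i) := rfl

/-- Positive real ideles act on archimedean coordinates as real scalars: `(z(r) x)_∞ = r x_∞`.
[folklore] -/
theorem vecInfinitePart_posRealIdele_smul (r : ℝ≥0ˣ) (x : Fin n → AdeleRing (𝓞 K) K) :
    vecInfinitePart K n (((posRealIdele K r : (AdeleRing (𝓞 K) K)ˣ) : AdeleRing (𝓞 K) K) • x) =
      ((r : ℝ≥0) : ℝ) • vecInfinitePart K n x := by
  rw [vecInfinitePart_smul, posRealIdele_fst, ringEquiv_mixedSpace_realToInfiniteAdele,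
    algebraMap_smul]

/-- `ξ = (ξ g) g⁻¹` for the principal vector of `ξ` and `g ∈ GL_n(𝔸_K)`. [folklore] -/
theorem ratVec_eq_vecMul_vecMul_inv (v : Fin n → K) (g : GL (Fin n) (AdeleRing (𝓞 K) K)) :
    ratVec K v = ratVec K v ᵥ* (g : Matrix (Fin n) (Fin n) (AdeleRing (𝓞 K) K)) ᵥ*
      ((g⁻¹ : GL (Fin n) (AdeleRing (𝓞 K) K)) : Matrix (Fin n) (Fin n) (AdeleRing (𝓞 K) K)) := by
  rw [Matrix.vecMul_vecMul, ← Matrix.GeneralLinearGroup.coe_mul, mul_inv_cancel,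
    Matrix.GeneralLinearGroup.coe_one, Matrix.vecMul_one]

/-- `ι(ξ_i)`, `ι` the Minkowski embedding, is bounded by the archimedean size of `ξ g`:
`‖ι(ξ_i)‖ ≤ (∑_{k,l} ‖(g⁻¹)_{∞,kl}‖) ‖(ξ g)_∞‖`. [folklore] -/
theorem norm_mixedEmbedding_le_mul_norm_vecInfinitePart (v : Fin n → K)
    (g : GL (Fin n) (AdeleRing (𝓞 K) K)) (i : Fin n) :
    ‖mixedEmbedding K (v i)‖ ≤
      (∑ k, ∑ l, ‖(((g⁻¹ : GL (Fin n) (AdeleRing (𝓞 K) K)) :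
          Matrix (Fin n) (Fin n) (AdeleRing (𝓞 K) K)).map
            fun a => InfiniteAdeleRing.ringEquiv_mixedSpace K a.1) k l‖) *
        ‖vecInfinitePart K n (ratVec K v ᵥ* (g : Matrix (Fin n) (Fin n) (AdeleRing (𝓞 K) K)))‖ := by
  have h := congrArg (vecInfinitePart K n) (ratVec_eq_vecMul_vecMul_inv K v g)
  rw [vecInfinitePart_vecMul, vecInfinitePart_ratVec] at h
  have hi : mixedEmbedding K (v i) = (fun i => mixedEmbedding K (v i)) i := rfl
  rw [hi]
  refine (norm_le_pi_norm (fun i => mixedEmbedding K (v i)) i).trans ?_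
  rw [h]
  exact norm_vecMul_le _ _

/-- **`(ξ g)_∞ ≠ 0` for `ξ ≠ 0`** (the Minkowski embedding is injective and `g_∞` is
invertible). [folklore] -/
theorem norm_vecInfinitePart_ratVec_vecMul_pos {v : Fin n → K} (hv : v ≠ 0)
    (g : GL (Fin n) (AdeleRing (𝓞 K) K)) :
    0 < ‖vecInfinitePart K n (ratVec K v ᵥ* (g : Matrix (Fin n) (Fin n) (AdeleRing (𝓞 K) K)))‖ := by
  obtain ⟨i, hi⟩ : ∃ i, v i ≠ 0 := by
    by_contra h
    push Not at h
    exact hv (funext h)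
  have hne : mixedEmbedding K (v i) ≠ 0 := by
    rwa [Ne, map_eq_zero_iff _ (mixedEmbedding_injective K)]
  have hpos : 0 < ‖mixedEmbedding K (v i)‖ := norm_pos_iff.2 hne
  have h := norm_mixedEmbedding_le_mul_norm_vecInfinitePart K v g i
  by_contra hle
  push Not at hle
  have h0 : ‖vecInfinitePart K n (ratVec K v ᵥ* (g : Matrix (Fin n) (Fin n) (AdeleRing (𝓞 K) K)))‖ = 0 :=
    le_antisymm hle (norm_nonneg _)
  rw [h0, mul_zero] at h
  exact absurd (hpos.trans_le h) (lt_irrefl _)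

end Coordinates

/-! ### Counting rational vectors by the size of `ξ g` -/

section Count

variable (K : Type) [Field K] [NumberField K] {n : ℕ}

/-- The adelic box `{x : ‖x_∞‖ ≤ 1, x_f ∈ C}` over a compact `C ⊆ 𝔸_K^∞` is compact (the image
of `B̄(0, 1) × C` under `(y, c) ↦ (e⁻¹ y, c)`, `e : K_∞ ≃ K ⊗ ℝ`). [folklore] -/
theorem isCompact_setOf_norm_le_one_and_mem {C : Set (FiniteAdeleRing (𝓞 K) K)} (hC : IsCompact C) :
    IsCompact {x : AdeleRing (𝓞 K) K |
      ‖InfiniteAdeleRing.ringEquiv_mixedSpace K x.1‖ ≤ 1 ∧ x.2 ∈ C} := by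
  set F : mixedSpace K × FiniteAdeleRing (𝓞 K) K → AdeleRing (𝓞 K) K :=
    fun p => ((InfiniteAdeleRing.ringEquiv_mixedSpace K).symm p.1, p.2) with hF
  have hFc : Continuous F :=
    continuous_prodMk.2
      ⟨(continuous_ringEquiv_mixedSpace_symm K).comp continuous_fst, continuous_snd⟩
  have hT : IsCompact (F '' (Metric.closedBall (0 : mixedSpace K) 1 ×ˢ C)) :=
    ((isCompact_closedBall _ _).prod hC).image hFc
  have e : {x : AdeleRing (𝓞 K) K |
      ‖InfiniteAdeleRing.ringEquiv_mixedSpace K x.1‖ ≤ 1 ∧ x.2 ∈ C} =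
        F '' (Metric.closedBall (0 : mixedSpace K) 1 ×ˢ C) := by
    ext x
    constructor
    · rintro ⟨hx1, hx2⟩
      refine ⟨(InfiniteAdeleRing.ringEquiv_mixedSpace K x.1, x.2), ⟨?_, hx2⟩, ?_⟩
      · rwa [Metric.mem_closedBall, dist_zero_right]
      · change (((InfiniteAdeleRing.ringEquiv_mixedSpace K).symm
          (InfiniteAdeleRing.ringEquiv_mixedSpace K x.1), x.2) : AdeleRing (𝓞 K) K) = x
        rw [RingEquiv.symm_apply_apply]
        rfl
    · rintro ⟨p, ⟨hp1, hp2⟩, rfl⟩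
      rw [Metric.mem_closedBall, dist_zero_right] at hp1
      refine ⟨?_, hp2⟩
      change ‖InfiniteAdeleRing.ringEquiv_mixedSpace K
        ((InfiniteAdeleRing.ringEquiv_mixedSpace K).symm p.1)‖ ≤ 1
      rwa [RingEquiv.apply_symm_apply]
  rw [e]
  exact hT

/-- **Counting rational vectors by the size of `ξ g`.** For `g ∈ GL_n(𝔸_K)` and a compact set
`C` of finite-adelic vectors there is `C₀ > 0` such that for every `R > 0` the rational row
vectors `ξ ∈ Kⁿ` with `(ξ g)_f ∈ C` and `‖(ξ g)_∞‖ ≤ R` are finite in number, at most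
`C₀ · max(1, R)^{n [K:ℚ]}`. Proof: `ξ = (ξ g) g⁻¹`, so each coordinate `ξ_i` is a field element
whose finite adele lies in a fixed compact set and whose Minkowski image has norm
`≤ (∑ ‖(g⁻¹)_∞‖) R`; count each coordinate by `ncard_algebraMap_mem_realAdele_smul_le`
(`AdelicBoxCount`) and multiply. (Borel (1969), §8; Godement–Jacquet (1972), proof of Lemma 11.6.)
[cite: Borel1969, §8] -/
theorem finite_ncard_ratVec_vecMul_le (g : GL (Fin n) (AdeleRing (𝓞 K) K))
    {C : Set (Fin n → FiniteAdeleRing (𝓞 K) K)} (hC : IsCompact C) :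
    ∃ C₀ : ℝ, 0 < C₀ ∧ ∀ R : ℝ, 0 < R →
      {v : Fin n → K | vecFinitePart K n (ratVec K v ᵥ* (g : Matrix (Fin n) (Fin n) (AdeleRing (𝓞 K) K))) ∈ C ∧
          ‖vecInfinitePart K n (ratVec K v ᵥ* (g : Matrix (Fin n) (Fin n) (AdeleRing (𝓞 K) K)))‖ ≤ R}.Finite ∧
        (({v : Fin n → K | vecFinitePart K n (ratVec K v ᵥ* (g : Matrix (Fin n) (Fin n) (AdeleRing (𝓞 K) K))) ∈ C ∧
          ‖vecInfinitePart K n (ratVec K v ᵥ* (g : Matrix (Fin n) (Fin n) (AdeleRing (𝓞 K) K)))‖ ≤ R}.ncard : ℕ) : ℝ) ≤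
          C₀ * max 1 R ^ (n * finrank ℚ K) := by
  -- notation: `A = g⁻¹`, its archimedean and finite parts, the size `G` of `A_∞`
  set A : Matrix (Fin n) (Fin n) (AdeleRing (𝓞 K) K) :=
    ((g⁻¹ : GL (Fin n) (AdeleRing (𝓞 K) K)) : Matrix (Fin n) (Fin n) (AdeleRing (𝓞 K) K)) with hA
  set Ainf : Matrix (Fin n) (Fin n) (mixedSpace K) :=
    A.map fun a => InfiniteAdeleRing.ringEquiv_mixedSpace K a.1 with hAinf
  set Af : Matrix (Fin n) (Fin n) (FiniteAdeleRing (𝓞 K) K) := A.map Prod.snd with hAf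
  set G : ℝ := ∑ k, ∑ l, ‖Ainf k l‖ with hG
  have hG0 : 0 ≤ G := Finset.sum_nonneg fun k _ => Finset.sum_nonneg fun l _ => norm_nonneg _
  -- the compact sets of finite coordinates of `ξ = (ξ g) g⁻¹`
  set Cf : Set (Fin n → FiniteAdeleRing (𝓞 K) K) := (fun z => z ᵥ* Af) '' C with hCf
  have hCfc : IsCompact Cf := hC.image (continuous_id.matrix_vecMul continuous_const)
  set Ci : Fin n → Set (FiniteAdeleRing (𝓞 K) K) := fun i =>
    (fun z : Fin n → FiniteAdeleRing (𝓞 K) K => z i) '' Cf with hCi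
  have hCic : ∀ i, IsCompact (Ci i) := fun i => hCfc.image (continuous_apply i)
  -- the compact adelic boxes, and the counting constants of `AdelicBoxCount`
  set B : Fin n → Set (AdeleRing (𝓞 K) K) := fun i =>
    {x | ‖InfiniteAdeleRing.ringEquiv_mixedSpace K x.1‖ ≤ 1 ∧ x.2 ∈ Ci i} with hB
  have hBc : ∀ i, IsCompact (B i) := fun i => isCompact_setOf_norm_le_one_and_mem K (hCic i)
  choose c hc hcount using fun i => ncard_algebraMap_mem_realAdele_smul_le K (hBc i)
  refine ⟨(∏ i, c i) * max 1 G ^ (n * finrank ℚ K),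
    mul_pos (Finset.prod_pos fun i _ => hc i) (by positivity), fun R hR => ?_⟩
  set ρ : ℝ := max 1 (G * R) with hρ
  have hρ1 : 1 ≤ ρ := le_max_left _ _
  have hρ0 : 0 < ρ := one_pos.trans_le hρ1
  -- the finite sets of admissible coordinates
  set T : Fin n → Set K := fun i =>
    {k : K | algebraMap K (AdeleRing (𝓞 K) K) k ∈ realAdele K ρ • B i} with hT
  have hTfin : ∀ i, (T i).Finite := fun i => (hcount i ρ hρ0).1
  have hTle : ∀ i, (((T i).ncard : ℕ) : ℝ) ≤ c i * max 1 ρ ^ finrank ℚ K :=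
    fun i => (hcount i ρ hρ0).2
  set S : Set (Fin n → K) :=
    {v : Fin n → K | vecFinitePart K n (ratVec K v ᵥ* (g : Matrix (Fin n) (Fin n) (AdeleRing (𝓞 K) K))) ∈ C ∧
      ‖vecInfinitePart K n (ratVec K v ᵥ* (g : Matrix (Fin n) (Fin n) (AdeleRing (𝓞 K) K)))‖ ≤ R}
    with hS
  -- every `v ∈ S` has all its coordinates in the `T i`
  have hmem : ∀ v ∈ S, ∀ i, v i ∈ T i := by
    rintro v ⟨hvf, hvi⟩ i
    have hdec := ratVec_eq_vecMul_vecMul_inv K v g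
    -- the finite coordinate
    have hfi : algebraMap K (FiniteAdeleRing (𝓞 K) K) (v i) ∈ Ci i := by
      have h := congrArg (vecFinitePart K n) hdec
      rw [vecFinitePart_vecMul, vecFinitePart_ratVec] at h
      exact ⟨_, ⟨_, hvf, rfl⟩, (congrFun h i).symm⟩
    -- the archimedean coordinate
    have hinf : ‖mixedEmbedding K (v i)‖ ≤ G * R :=
      (norm_mixedEmbedding_le_mul_norm_vecInfinitePart K v g i).trans
        (mul_le_mul_of_nonneg_left hvi hG0)
    -- the witness `b = (ρ⁻¹, 1) ξ_i ∈ B i`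
    change algebraMap K (AdeleRing (𝓞 K) K) (v i) ∈ realAdele K ρ • B i
    refine Set.mem_smul_set.2
      ⟨realAdele K ρ⁻¹ * algebraMap K (AdeleRing (𝓞 K) K) (v i), ⟨?_, ?_⟩, ?_⟩
    · change ‖InfiniteAdeleRing.ringEquiv_mixedSpace K
        ((realAdele K ρ⁻¹).1 * (algebraMap K (AdeleRing (𝓞 K) K) (v i)).1)‖ ≤ 1
      rw [map_mul, realAdele_fst, ringEquiv_mixedSpace_realToInfiniteAdele,
        AdeleRing.algebraMap_fst, ← InfiniteAdeleRing.mixedEmbedding_eq_algebraMap_comp,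
        ← Algebra.smul_def, _root_.norm_smul, Real.norm_eq_abs, abs_of_pos (inv_pos.2 hρ0),
        inv_mul_le_iff₀ hρ0, mul_one]
      exact hinf.trans (le_max_right _ _)
    · change (realAdele K ρ⁻¹).2 * (algebraMap K (AdeleRing (𝓞 K) K) (v i)).2 ∈ Ci i
      rw [realAdele_snd, one_mul, AdeleRing.algebraMap_snd]
      exact hfi
    · rw [smul_eq_mul, ← mul_assoc, ← realAdele_mul, mul_inv_cancel₀ hρ0.ne', realAdele_one,
        one_mul]
  -- `S` sits inside the finite product of the `T i`
  have hSsub : S ⊆ Set.pi Set.univ T := fun v hv i _ => hmem v hv i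
  have hPfin : (Set.pi Set.univ T).Finite := Set.Finite.pi fun i => hTfin i
  have hSfin : S.Finite := hPfin.subset hSsub
  refine ⟨hSfin, ?_⟩
  have hcard : (((Set.pi Set.univ T).ncard : ℕ) : ℝ) = ∏ i, (((T i).ncard : ℕ) : ℝ) := by
    have e : Set.pi Set.univ T = ↑(Fintype.piFinset fun i => (hTfin i).toFinset) := by
      rw [Fintype.coe_piFinset]
      congr 1
      funext i
      rw [Set.Finite.coe_toFinset]
    rw [e, Set.ncard_coe_finset, Fintype.card_piFinset]
    push_cast
    refine Finset.prod_congr rfl fun i _ => ?_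
    rw [Set.ncard_eq_toFinset_card _ (hTfin i)]
  have hρle : max 1 ρ ≤ max 1 G * max 1 R := by
    rw [max_eq_right hρ1]
    refine max_le (one_le_mul_of_one_le_of_one_le (le_max_left _ _) (le_max_left _ _)) ?_
    exact mul_le_mul (le_max_right _ _) (le_max_right _ _) hR.le
      (zero_le_one.trans (le_max_left _ _))
  have hpow : (max 1 ρ ^ finrank ℚ K) ^ n ≤ ((max 1 G * max 1 R) ^ finrank ℚ K) ^ n :=
    pow_le_pow_left₀ (by positivity) (pow_le_pow_left₀ (by positivity) hρle _) _
  calc ((S.ncard : ℕ) : ℝ) ≤ (((Set.pi Set.univ T).ncard : ℕ) : ℝ) := by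
        exact_mod_cast Set.ncard_le_ncard hSsub hPfin
    _ = ∏ i, (((T i).ncard : ℕ) : ℝ) := hcard
    _ ≤ ∏ i, c i * max 1 ρ ^ finrank ℚ K :=
        Finset.prod_le_prod (fun i _ => by positivity) fun i _ => hTle i
    _ = (∏ i, c i) * (max 1 ρ ^ finrank ℚ K) ^ n := by
        rw [Finset.prod_mul_distrib, Finset.prod_const, Finset.card_univ, Fintype.card_fin]
    _ ≤ (∏ i, c i) * ((max 1 G * max 1 R) ^ finrank ℚ K) ^ n :=
        mul_le_mul_of_nonneg_left hpow (Finset.prod_nonneg fun i _ => (hc i).le)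
    _ = (∏ i, c i) * max 1 G ^ (n * finrank ℚ K) * max 1 R ^ (n * finrank ℚ K) := by
        rw [mul_pow, mul_pow, ← pow_mul, ← pow_mul, mul_comm (finrank ℚ K) n]
        ring

/-! ### The lattice sums `∑ ‖(ξ g)_∞‖^{-θ}` -/

/-- **Convergence of the lattice sums.** For `g ∈ GL_n(𝔸_K)`, a compact set `C` of finite-adelic
vectors and `θ > n [K:ℚ]`,
`∑_{ξ ∈ Kⁿ ∖ 0, (ξ g)_f ∈ C} ‖(ξ g)_∞‖^{-θ} < ∞`
(the counting `finite_ncard_ratVec_vecMul_le` fed into the dyadic summation lemma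
`tsum_rpow_neg_lt_top_of_ncard_le`; `(ξ g)_∞ ≠ 0` by `norm_vecInfinitePart_ratVec_vecMul_pos`,
and the finitely many `ξ` with `‖(ξ g)_∞‖ ≤ 1` give the positive lower bound `m₀`). This is the
convergence of the Epstein-type zeta sums behind the absolute convergence of the mirabolic
Eisenstein series (Godement–Jacquet (1972), Lemma 11.5–11.6; Jacquet–Shalika (1981), §4).
[cite: GodementJacquetLNM260, §11] -/
theorem tsum_norm_vecInfinitePart_rpow_neg_lt_top (g : GL (Fin n) (AdeleRing (𝓞 K) K))
    {C : Set (Fin n → FiniteAdeleRing (𝓞 K) K)} (hC : IsCompact C) {θ : ℝ}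
    (hθ : (n : ℝ) * finrank ℚ K < θ) :
    ∑' v : ↥{v : Fin n → K | v ≠ 0 ∧
        vecFinitePart K n (ratVec K v ᵥ* (g : Matrix (Fin n) (Fin n) (AdeleRing (𝓞 K) K))) ∈ C},
      ENNReal.ofReal
        (‖vecInfinitePart K n (ratVec K (v : Fin n → K) ᵥ*
            (g : Matrix (Fin n) (Fin n) (AdeleRing (𝓞 K) K)))‖ ^ (-θ)) < ⊤ := by
  set Λ : Set (Fin n → K) := {v : Fin n → K | v ≠ 0 ∧
    vecFinitePart K n (ratVec K v ᵥ* (g : Matrix (Fin n) (Fin n) (AdeleRing (𝓞 K) K))) ∈ C} with hΛ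
  set N : (Fin n → K) → ℝ := fun v =>
    ‖vecInfinitePart K n (ratVec K v ᵥ* (g : Matrix (Fin n) (Fin n) (AdeleRing (𝓞 K) K)))‖ with hN
  obtain ⟨C₀, hC₀, hcount⟩ := finite_ncard_ratVec_vecMul_le K g hC
  -- the counting function of `Λ`
  have hcount' : ∀ R : ℝ, 0 < R → {ξ ∈ Λ | N ξ ≤ R}.Finite ∧
      (({ξ ∈ Λ | N ξ ≤ R}.ncard : ℕ) : ℝ) ≤ C₀ * max 1 R ^ ((n : ℝ) * finrank ℚ K) := by
    intro R hR
    obtain ⟨hfin, hle⟩ := hcount R hR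
    have hsub : {ξ ∈ Λ | N ξ ≤ R} ⊆
        {v : Fin n → K | vecFinitePart K n (ratVec K v ᵥ* (g : Matrix (Fin n) (Fin n) (AdeleRing (𝓞 K) K))) ∈ C ∧
          ‖vecInfinitePart K n (ratVec K v ᵥ* (g : Matrix (Fin n) (Fin n) (AdeleRing (𝓞 K) K)))‖ ≤ R} :=
      fun v hv => ⟨hv.1.2, hv.2⟩
    refine ⟨hfin.subset hsub, ?_⟩
    have hpow : max 1 R ^ ((n : ℝ) * finrank ℚ K) = max 1 R ^ (n * finrank ℚ K) := by
      rw [← Real.rpow_natCast, Nat.cast_mul]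
    rw [hpow]
    exact le_trans (by exact_mod_cast Set.ncard_le_ncard hsub hfin) hle
  -- positivity of `N` on `Λ` and the lower bound `m₀`
  have hpos : ∀ v ∈ Λ, 0 < N v := fun v hv => norm_vecInfinitePart_ratVec_vecMul_pos K hv.1 g
  obtain ⟨hFfin, -⟩ := hcount' 1 one_pos
  obtain ⟨m₀, hm₀, hmin⟩ : ∃ m₀ : ℝ, 0 < m₀ ∧ ∀ ξ ∈ Λ, m₀ ≤ N ξ := by
    by_cases hF : {ξ ∈ Λ | N ξ ≤ 1}.Nonempty
    · have hF' : hFfin.toFinset.Nonempty := by rwa [Set.Finite.toFinset_nonempty]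
      obtain ⟨ξ₀, hξ₀, hξ₀min⟩ := hFfin.toFinset.exists_min_image N hF'
      rw [Set.Finite.mem_toFinset] at hξ₀
      refine ⟨min 1 (N ξ₀), lt_min one_pos (hpos ξ₀ hξ₀.1), fun ξ hξ => ?_⟩
      by_cases h1 : N ξ ≤ 1
      · exact (min_le_right _ _).trans (hξ₀min ξ (by rw [Set.Finite.mem_toFinset]; exact ⟨hξ, h1⟩))
      · exact (min_le_left _ _).trans (le_of_lt (not_le.1 h1))
    · refine ⟨1, one_pos, fun ξ hξ => ?_⟩
      by_contra h1
      exact hF ⟨ξ, hξ, le_of_lt (not_le.1 h1)⟩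
  exact tsum_rpow_neg_lt_top_of_ncard_le hm₀ hC₀.le (by positivity) hmin hcount' hθ

end Count

end Literature.NumberTheory.Automorphic
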